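import Literature.MathematicalPhysics.QuantumFieldTheory.Balaban1983to89.B1Eq324BenfattoKernelComparisonExtensive
import Literature.MathematicalPhysics.QuantumFieldTheory.Balaban1983to89.B1Eq324BenfattoClassComparisonBoxes
import HarnessLib

/-!
# `Balaban1983to89.B1Eq324BenfattoKernelComparisonBoxes` — [BenfattoEtAl1978] §5 (5.13) p. 155 for the class of
# [Balaban1985BackgroundPropagators] Sect. E p. 428: the PER-BOX LAWS of the comparison fields of the decoupling estimate, and the class
# substitute for «the integral factorizes over the boxes» as ONE two-sided theorem on the conditioned field, PROVED

statement-level skeleton of published theorems with citation tags; proofs where landed; nothing here is a claim about the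
Yang–Mills mass gap

WHY THIS MODULE (cell `pub-ymgap`, seat `dag-n08-d` gen 12; the piece «J4» located for this seat by seat n08-b (gen 8) and by gen 11 of this
seat; node N08 [Balaban1985UV3]; the [BenfattoEtAl1978] source chain behind the (α)-row `h324`).  At T. Bałaban's data the fluctuation-field
precision is exponentially decaying, not of finite range ([Balaban1985BackgroundPropagators] Sect. E p. 428, (3.156)), so print's exact Markov
step (5.13) p. 155 «the integral factorizes» over the boxes `□` of a pavement is replaced by a two-sided DECOUPLING estimate.  The pieces are in
the tree: seat n08-b's `…ClassDecouplingExtensive.decoupling_extensive` (the conditional precision `B = A|_{Λ∖Γ}` is sandwiched by its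
block-diagonal part shifted by the diagonal of its cross row sums, `B_bd − diag r ≤ B ≤ B_bd + diag r`, normalisations within `e^{±ρ}`,
`ρ = Σ_y r_y/(γ − r_max)`), its delivery on the conditioned class field `P̄^K_{Γ,z̄}` (`…KernelComparisonExtensive`, «J3»), the independence of
kernel-decoupled regions under a shifted Gaussian field (`…KernelComparison` §4, «J2»), and — on the MATRIX side — what the box marginals of the
comparison measures ARE (`…ClassComparisonBoxes.map_restrictJ_multivariateGaussian_comparison`: `N(u|_p, (B|_p + c·diag r|_p)⁻¹)`).  This file
is the FIELD-side twin of the last item and the composition of all four: (i) the finite-window laws of the zero-extended Gaussian field of a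
precision with no entries across a partition are the inverted diagonal BLOCKS (window = a union of parts), (ii) for the comparison precisions
`(A|_{Λ∖Γ})_bd + c·diag r` the block of a box is `A|_{box} + c·diag(r|_{box})` — the Dirichlet box precision OF THE ORIGINAL FIELD at a shifted
temperature —, (iii) hence the per-box law of the comparison field, and (iv) the class (5.13): for non-negative observables `F_p` of the box
fields, `∫ Π_p F_p dP̄^K_{Γ,z̄}` is bounded above by `e^{ρ}` times, and below by `e^{−ρ}` times, the PRODUCT over the boxes of the box Gaussian
integrals `∫ F_p dN(u_Γ(z̄)|_{box p}, (A|_{box p} ∓ diag r|_{box p})⁻¹)` — the statement a class edition of the §5 chain consumes where the free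
field used `…Sect5Eq515.integral_boxes_factorise_eq`, with the comparison kernel instantiated inside the proof so that only `A, Γ, π, r, z̄, F`
appear.

WHAT IS PROVED (standard axioms; no `sorry`; no definition).
* §1 WINDOWS OF A BLOCK-STRUCTURED PRECISION (`Λ′ ⊂ Q₀` finite, `P : Matrix Λ′ Λ′ ℝ`, `hK₂ : K₂ x y = [x,y∈Λ′]·(P⁻¹)_{xy}`, a labelling
  `π : Λ′ → σ` with `P y y′ = 0` whenever `π y ≠ π y′`): `covGram_kernel_eq_inv` (`K₂_{Λ′Λ′} = P⁻¹`), ★ `covGram_kernel_eq_inv_submatrix_of_saturated`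
  (for a `π`-saturated window `I ⊆ Λ′`, `K₂_II = (P|_I)⁻¹` — seat n08-b's `submatrix_inv_of_blockDiag` read on `Q₀`-windows),
  ★ `lintegral_comp_restrict_shift_window_eq` (`P ≻ 0`: `∫⁻ F(z|_I) d[𝒩(0,K₂)∘(u+·)⁻¹] = ∫⁻ F dN(u|_I, (P|_I)⁻¹)`).
* §2 THE COMPARISON BOXES IN THE `A`-CURRENCY (`Λ`, `A : Matrix Λ Λ ℝ`, corridors `Γ`, partition `π` of `↥(Λ ∖ Γ)`, `r : ↥(Λ ∖ Γ) → ℝ`, a box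
  `I ⊆ Λ ∖ Γ` with `y ∈ I ↔ π y = p`): `comparisonPrecision_apply_eq_zero_of_ne` / `comparisonPrecision_sub_apply_eq_zero_of_ne`
  (no entries across the parts), `comparisonPrecision_submatrix_box_eq` / `comparisonPrecision_sub_submatrix_box_eq`
  (`((A|_{Λ∖Γ})_bd + c·diag r)|_I = A|_I + c·diag(r|_I)`, and the `−` edition), ★★ `lintegral_comp_restrict_comparison_box_eq` — THE PER-BOX LAW OF
  THE COMPARISON FIELD: `∫⁻ F(z|_I) d[𝒩(0,K₂)∘(u+·)⁻¹] = ∫⁻ F dN(u|_I, (A|_I + c·diag(r|_I))⁻¹)` (the field twin of n08-b's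
  `map_restrictJ_multivariateGaussian_comparison`).
* §3 ★★★ `lintegral_prod_restrict_condFieldK_le_exp_mul_prod` / `exp_mul_prod_lintegral_le_lintegral_prod_restrict_condFieldK` — THE CLASS (5.13):
  in the setting of `…KernelComparisonExtensive` (class kernel `hK : K x y = [x,y∈Λ]·(A⁻¹)_{xy}` of a symmetric `γ`-coercive `A`, `Γ ⊆ Λ`, boxes
  `box p = {y ∈ Λ∖Γ : π y = p}` given as `Finset`s, cross-row-sum bounds `Σ_{π y′ ≠ π y}|A_{yy′}| ≤ r_y ≤ r_max < γ`), for measurable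
  `F_p : (box p → ℝ) → ℝ≥0∞`:
  `∫⁻ Π_p F_p(z|_{box p}) dP̄^K_{Γ,z̄} ≤ e^{ρ} · Π_p ∫⁻ F_p dN(u_Γ(z̄)|_{box p}, (A|_{box p} − diag(r|_{box p}))⁻¹)` and
  `e^{−ρ} · Π_p ∫⁻ F_p dN(u_Γ(z̄)|_{box p}, (A|_{box p} + diag(r|_{box p}))⁻¹) ≤ ∫⁻ Π_p F_p(z|_{box p}) dP̄^K_{Γ,z̄}`, `ρ = (Σ_y r_y)/(γ − r_max)`
  (J3's domination + J2's independence of decoupled regions + Mathlib's `lintegral_prod_eq_prod_lintegral_of_indepFun` + §2).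
HONEST SCOPE.  Transport and assembly only — the estimates are seat n08-b's; the class and the substitute for (5.13) are OUR reading of
[Balaban1985BackgroundPropagators] p. 428 for [Balaban1982Higgs1] p. 616, not print; nothing of [Balaban1985UV3] / [Balaban1985UV2] is asserted;
no generalised Basic Lemma is stated; the §5-side port is not begun here; count-neutral for N08; nothing about d = 4, the continuum, OS axioms,
a mass gap or the Clay problem.
-/

noncomputable section

open MeasureTheory ProbabilityTheory Finset Matrix WithLp
open scoped BigOperators Matrix NNReal ENNReal

namespace Literature.MathematicalPhysics.QuantumFieldTheory.Balaban1983to89.B1Eq324BenfattoKernelComparisonBoxes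

open Literature.MathematicalPhysics.QuantumFieldTheory
open Literature.MathematicalPhysics.QuantumFieldTheory.Balaban1983to89.B1Eq324BenfattoLemma
open Literature.MathematicalPhysics.QuantumFieldTheory.Balaban1983to89.B1Eq324BenfattoKernelRegression
open Literature.MathematicalPhysics.QuantumFieldTheory.Balaban1983to89.B1Eq324BenfattoKernelOfPrecision
open Literature.MathematicalPhysics.QuantumFieldTheory.Balaban1983to89.B1Eq324BenfattoKernelComparison
open Literature.MathematicalPhysics.QuantumFieldTheory.Balaban1983to89.B1Eq324BenfattoKernelComparisonExtensive
open Literature.MathematicalPhysics.QuantumFieldTheory.Balaban1983to89.B1Eq324BenfattoClassAppendixC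
open Literature.MathematicalPhysics.QuantumFieldTheory.Balaban1983to89.B1Eq324BenfattoClassDecoupling
open Literature.MathematicalPhysics.QuantumFieldTheory.Balaban1983to89.B1Eq324BenfattoClassDecouplingExtensive

variable {d : ℕ}

/-! ## §1  Windows of the zero-extended field of a precision with no entries across a partition -/

section Windows

variable {Λ' : Finset (B1Eq324BenfattoLemma.Site d)} {P : Matrix Λ' Λ' ℝ}
  {K₂ : B1Eq324BenfattoLemma.Site d → B1Eq324BenfattoLemma.Site d → ℝ}
  (hK₂ : ∀ x y, K₂ x y = if h : x ∈ Λ' ∧ y ∈ Λ' then (P⁻¹ : Matrix Λ' Λ' ℝ) ⟨x, h.1⟩ ⟨y, h.2⟩ else 0)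

include hK₂

/-- **The Gram matrix of the zero-extended kernel on its own support is the covariance `P⁻¹`.**
[cite: BenfattoEtAl1978, Appendix C (C.6) p.164 (class form); HornJohnson2013, §0.7.3] -/
theorem covGram_kernel_eq_inv : covGram K₂ Λ' = P⁻¹ := by
  ext a b
  rw [covGram_apply, hK₂, dif_pos ⟨a.2, b.2⟩]

/-- **On a saturated window the Gram matrix is the inverse of the precision BLOCK.**  If `P` has no entries across the labelling `π`
(`P y y′ = 0` whenever `π y ≠ π y′`) and the window `I ⊆ Λ′` is `π`-saturated (with a site it contains the whole part of that site), then
`K₂_II = (P|_I)⁻¹` — the inverse of a block-diagonal matrix is block-diagonal with the inverse blocks (seat n08-b's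
`…ClassComparisonBoxes.submatrix_inv_of_blockDiag`, read on `Q₀`-windows through `I ≃ I.subtype (· ∈ Λ′)`).
[cite: HornJohnson2013, §0.9.2 (block diagonal matrices); BenfattoEtAl1978, §5 (5.13) p.155 (class substitute; ours)] -/
theorem covGram_kernel_eq_inv_submatrix_of_saturated {σ : Type*} (hP : IsUnit P.det) (π : ↥Λ' → σ)
    (hbd : ∀ y y' : ↥Λ', π y ≠ π y' → P y y' = 0) {I : Finset (B1Eq324BenfattoLemma.Site d)} (hI : I ⊆ Λ')
    (hsat : ∀ y y' : ↥Λ', (y : B1Eq324BenfattoLemma.Site d) ∈ I → π y' = π y → (y' : B1Eq324BenfattoLemma.Site d) ∈ I) :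
    covGram K₂ I = (P.submatrix (fun j : ↥I => (⟨j, hI j.2⟩ : ↥Λ')) (fun j : ↥I => (⟨j, hI j.2⟩ : ↥Λ')))⁻¹ := by
  classical
  -- the window read inside `↥Λ′`
  set T : Finset ↥Λ' := I.subtype (· ∈ Λ') with hT
  have hTsat : ∀ y ∈ T, ∀ y', π y' = π y → y' ∈ T := fun y hy y' hyy' =>
    Finset.mem_subtype.mpr (hsat y y' (Finset.mem_subtype.mp hy) hyy')
  have hblock := B1Eq324BenfattoClassComparisonBoxes.submatrix_inv_of_blockDiag hP π hbd T hTsat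
  -- reindex `↥I ≃ ↥T`
  let e : ↥I ≃ ↥T :=
    { toFun := fun j => ⟨⟨j, hI j.2⟩, Finset.mem_subtype.mpr j.2⟩
      invFun := fun t => ⟨((t : ↥Λ') : B1Eq324BenfattoLemma.Site d), Finset.mem_subtype.mp t.2⟩
      left_inv := fun j => rfl
      right_inv := fun t => rfl }
  have hincl : (fun j : ↥I => (⟨j, hI j.2⟩ : ↥Λ')) = (fun j : ↥T => (j : ↥Λ')) ∘ e := rfl
  rw [covGram_kernel_eq_submatrix hK₂ hI, hincl, ← Matrix.submatrix_submatrix, ← Matrix.submatrix_submatrix P,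
    Matrix.inv_submatrix_equiv, hblock]

/-- **THE WINDOW LAW OF THE SHIFTED COMPARISON FIELD**: for a positive-definite precision `P` on `Λ′` with no entries across `π`, a
`π`-saturated window `I ⊆ Λ′` and any shift `u`, `∫⁻ F(z|_I) d[𝒩(0,K₂) ∘ (u + ·)⁻¹] = ∫⁻ F dN(u|_I, (P|_I)⁻¹)` — the window marginal of the
zero-extended field is the Gaussian of the inverted BLOCK (`…KernelComparison.lintegral_comp_restrict_shift_eq` + the blockwise inverse).
[cite: BenfattoEtAl1978, §5 (5.13) p.155; Appendix C 2) p.164 (class substitute; ours)] -/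
theorem lintegral_comp_restrict_shift_window_eq {σ : Type*} (hPD : P.PosDef) (π : ↥Λ' → σ)
    (hbd : ∀ y y' : ↥Λ', π y ≠ π y' → P y y' = 0) {I : Finset (B1Eq324BenfattoLemma.Site d)} (hI : I ⊆ Λ')
    (hsat : ∀ y y' : ↥Λ', (y : B1Eq324BenfattoLemma.Site d) ∈ I → π y' = π y → (y' : B1Eq324BenfattoLemma.Site d) ∈ I)
    (u : B1Eq324BenfattoLemma.Site d → ℝ) {F : (↥I → ℝ) → ℝ≥0∞} (hF : Measurable F) :
    ∫⁻ z, F (I.restrict z) ∂((gaussianFieldOfKernel K₂).map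
        fun (ζ : B1Eq324BenfattoLemma.Site d → ℝ) (x : B1Eq324BenfattoLemma.Site d) => u x + ζ x) =
      ∫⁻ y, F (ofLp y) ∂multivariateGaussian (toLp 2 (I.restrict u))
        (P.submatrix (fun j : ↥I => (⟨j, hI j.2⟩ : ↥Λ')) (fun j : ↥I => (⟨j, hI j.2⟩ : ↥Λ')))⁻¹ := by
  have hdet : IsUnit P.det := (Matrix.isUnit_iff_isUnit_det P).mp hPD.isUnit
  rw [lintegral_comp_restrict_shift_eq (isPosSemidefKernel_kernel hK₂ hPD) u I hF,
    covGram_kernel_eq_inv_submatrix_of_saturated hK₂ hdet π hbd hI hsat]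

end Windows

/-! ## §2  The comparison boxes of `decoupling_extensive`, in the `A`-currency -/

section Boxes

variable {Λ : Finset (B1Eq324BenfattoLemma.Site d)} {A : Matrix Λ Λ ℝ}

/-- **A box is a saturated window**: if `I` is the set of sites of the part `p` (`y ∈ I ↔ π y = p` on `Λ ∖ Γ`), then with a site it contains
every site of the same part. [folklore] -/
private theorem saturated_of_box {σ : Type*} {Γ : Finset (B1Eq324BenfattoLemma.Site d)} (π : ↥(Λ \ Γ) → σ) (p : σ)
    {I : Finset (B1Eq324BenfattoLemma.Site d)} (hbox : ∀ y : ↥(Λ \ Γ), (y : B1Eq324BenfattoLemma.Site d) ∈ I ↔ π y = p) :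
    ∀ y y' : ↥(Λ \ Γ), (y : B1Eq324BenfattoLemma.Site d) ∈ I → π y' = π y → (y' : B1Eq324BenfattoLemma.Site d) ∈ I :=
  fun y y' hy hyy' => (hbox y').mpr (hyy'.trans ((hbox y).mp hy))

/-- **The comparison precisions have no entries across the parts** (`+ c·diag r` edition).
[cite: BenfattoEtAl1978, §5 (5.13) p.155 (class substitute; ours)] -/
theorem comparisonPrecision_apply_eq_zero_of_ne {σ : Type*} [DecidableEq σ] {Γ : Finset (B1Eq324BenfattoLemma.Site d)} (π : ↥(Λ \ Γ) → σ)
    (r : ↥(Λ \ Γ) → ℝ) (c : ℝ) :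
    ∀ y y' : ↥(Λ \ Γ), π y ≠ π y' →
      ((Matrix.of fun y y' : ↥(Λ \ Γ) => if π y = π y' then
          A ⟨y, (Finset.mem_sdiff.mp y.2).1⟩ ⟨y', (Finset.mem_sdiff.mp y'.2).1⟩ else 0) + c • Matrix.diagonal r) y y' = 0 := by
  classical
  intro y y' h
  have hne : y ≠ y' := fun h' => h (by rw [h'])
  simp only [Matrix.add_apply, Matrix.of_apply, if_neg h, Matrix.smul_apply, Matrix.diagonal_apply_ne _ hne, smul_zero, add_zero]

/-- **The comparison precisions have no entries across the parts** (`− diag r` edition).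
[cite: BenfattoEtAl1978, §5 (5.13) p.155 (class substitute; ours)] -/
theorem comparisonPrecision_sub_apply_eq_zero_of_ne {σ : Type*} [DecidableEq σ] {Γ : Finset (B1Eq324BenfattoLemma.Site d)} (π : ↥(Λ \ Γ) → σ)
    (r : ↥(Λ \ Γ) → ℝ) :
    ∀ y y' : ↥(Λ \ Γ), π y ≠ π y' →
      ((Matrix.of fun y y' : ↥(Λ \ Γ) => if π y = π y' then
          A ⟨y, (Finset.mem_sdiff.mp y.2).1⟩ ⟨y', (Finset.mem_sdiff.mp y'.2).1⟩ else 0) - Matrix.diagonal r) y y' = 0 := by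
  classical
  intro y y' h
  have hne : y ≠ y' := fun h' => h (by rw [h'])
  simp only [Matrix.sub_apply, Matrix.of_apply, if_neg h, Matrix.diagonal_apply_ne _ hne, sub_zero]

/-- **The box block of a comparison precision, in the `A`-currency**: for the box `I` of the part `p`,
`((A|_{Λ∖Γ})_bd + c·diag r)|_I = A|_I + c·diag(r|_I)` — the Dirichlet box precision of the ORIGINAL field shifted by a diagonal temperature term
(the `Q₀`-window reading of seat n08-b's `…ClassComparisonBoxes.comparisonPrecision_submatrix_part`).
[cite: BenfattoEtAl1978, §5 (5.13) p.155 (class substitute; ours)] -/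
theorem comparisonPrecision_submatrix_box_eq {σ : Type*} [DecidableEq σ] {Γ : Finset (B1Eq324BenfattoLemma.Site d)} (π : ↥(Λ \ Γ) → σ)
    (r : ↥(Λ \ Γ) → ℝ) (c : ℝ) (p : σ) {I : Finset (B1Eq324BenfattoLemma.Site d)} (hI : I ⊆ Λ \ Γ)
    (hbox : ∀ y : ↥(Λ \ Γ), (y : B1Eq324BenfattoLemma.Site d) ∈ I ↔ π y = p) :
    (((Matrix.of fun y y' : ↥(Λ \ Γ) => if π y = π y' then
          A ⟨y, (Finset.mem_sdiff.mp y.2).1⟩ ⟨y', (Finset.mem_sdiff.mp y'.2).1⟩ else 0) + c • Matrix.diagonal r).submatrix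
        (fun j : ↥I => (⟨j, hI j.2⟩ : ↥(Λ \ Γ))) (fun j : ↥I => (⟨j, hI j.2⟩ : ↥(Λ \ Γ)))) =
      A.submatrix (fun j : ↥I => (⟨j, (Finset.mem_sdiff.mp (hI j.2)).1⟩ : Λ))
          (fun j : ↥I => (⟨j, (Finset.mem_sdiff.mp (hI j.2)).1⟩ : Λ)) +
        c • Matrix.diagonal (fun j : ↥I => r ⟨j, hI j.2⟩) := by
  classical
  ext a b
  have ha : π ⟨a, hI a.2⟩ = p := (hbox ⟨a, hI a.2⟩).mp a.2
  have hb : π ⟨b, hI b.2⟩ = p := (hbox ⟨b, hI b.2⟩).mp b.2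
  simp only [Matrix.submatrix_apply, Matrix.add_apply, Matrix.of_apply, Matrix.smul_apply, smul_eq_mul]
  rw [if_pos (ha.trans hb.symm)]
  by_cases hab : a = b
  · subst hab
    rw [Matrix.diagonal_apply_eq, Matrix.diagonal_apply_eq]
  · have hab' : (⟨(a : B1Eq324BenfattoLemma.Site d), hI a.2⟩ : ↥(Λ \ Γ)) ≠ ⟨(b : B1Eq324BenfattoLemma.Site d), hI b.2⟩ :=
      fun h => hab (Subtype.ext (congrArg (fun y : ↥(Λ \ Γ) => (y : B1Eq324BenfattoLemma.Site d)) h))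
    rw [Matrix.diagonal_apply_ne _ hab', Matrix.diagonal_apply_ne _ hab]

/-- **The box block of the lower comparison precision `(A|_{Λ∖Γ})_bd − diag r`**: `A|_I − diag(r|_I)`.
[cite: BenfattoEtAl1978, §5 (5.13) p.155 (class substitute; ours)] -/
theorem comparisonPrecision_sub_submatrix_box_eq {σ : Type*} [DecidableEq σ] {Γ : Finset (B1Eq324BenfattoLemma.Site d)} (π : ↥(Λ \ Γ) → σ)
    (r : ↥(Λ \ Γ) → ℝ) (p : σ) {I : Finset (B1Eq324BenfattoLemma.Site d)} (hI : I ⊆ Λ \ Γ)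
    (hbox : ∀ y : ↥(Λ \ Γ), (y : B1Eq324BenfattoLemma.Site d) ∈ I ↔ π y = p) :
    (((Matrix.of fun y y' : ↥(Λ \ Γ) => if π y = π y' then
          A ⟨y, (Finset.mem_sdiff.mp y.2).1⟩ ⟨y', (Finset.mem_sdiff.mp y'.2).1⟩ else 0) - Matrix.diagonal r).submatrix
        (fun j : ↥I => (⟨j, hI j.2⟩ : ↥(Λ \ Γ))) (fun j : ↥I => (⟨j, hI j.2⟩ : ↥(Λ \ Γ)))) =
      A.submatrix (fun j : ↥I => (⟨j, (Finset.mem_sdiff.mp (hI j.2)).1⟩ : Λ))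
          (fun j : ↥I => (⟨j, (Finset.mem_sdiff.mp (hI j.2)).1⟩ : Λ)) -
        Matrix.diagonal (fun j : ↥I => r ⟨j, hI j.2⟩) := by
  have h := comparisonPrecision_submatrix_box_eq (A := A) π r (-1) p hI hbox
  rw [neg_one_smul, neg_one_smul, ← sub_eq_add_neg, ← sub_eq_add_neg] at h
  exact h

/-- **THE PER-BOX LAW OF THE COMPARISON FIELD** — the field twin of seat n08-b's `…ClassComparisonBoxes.map_restrictJ_multivariateGaussian_comparison`.
For a positive-definite comparison precision `N = (A|_{Λ∖Γ})_bd + c·diag r`, its zero-extended kernel `K₂` on `Q₀`, the box `I` of the part `p`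
and any centre `u`: `∫⁻ F(z|_I) d[𝒩(0,K₂) ∘ (u + ·)⁻¹] = ∫⁻ F dN(u|_I, (A|_I + c·diag(r|_I))⁻¹)` — after the (5.13)-substitute, THIS is the measure
under which the per-box steps (5.14)–(5.22) / (5.36) of a class edition are run: the Dirichlet box Gaussian of the original field at a shifted
temperature. [cite: BenfattoEtAl1978, §5 (5.13) p.155, p.153 «factorize “over the boxes □”» (class substitute; ours)] -/
theorem lintegral_comp_restrict_comparison_box_eq {σ : Type*} [DecidableEq σ] {Γ : Finset (B1Eq324BenfattoLemma.Site d)} (π : ↥(Λ \ Γ) → σ)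
    (r : ↥(Λ \ Γ) → ℝ) (c : ℝ)
    (hPD : ((Matrix.of fun y y' : ↥(Λ \ Γ) => if π y = π y' then
        A ⟨y, (Finset.mem_sdiff.mp y.2).1⟩ ⟨y', (Finset.mem_sdiff.mp y'.2).1⟩ else 0) + c • Matrix.diagonal r).PosDef)
    {K₂ : B1Eq324BenfattoLemma.Site d → B1Eq324BenfattoLemma.Site d → ℝ}
    (hK₂ : ∀ x y, K₂ x y = if h : x ∈ Λ \ Γ ∧ y ∈ Λ \ Γ then
      (((Matrix.of fun y y' : ↥(Λ \ Γ) => if π y = π y' then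
          A ⟨y, (Finset.mem_sdiff.mp y.2).1⟩ ⟨y', (Finset.mem_sdiff.mp y'.2).1⟩ else 0) + c • Matrix.diagonal r)⁻¹ :
        Matrix ↥(Λ \ Γ) ↥(Λ \ Γ) ℝ) ⟨x, h.1⟩ ⟨y, h.2⟩ else 0)
    (p : σ) {I : Finset (B1Eq324BenfattoLemma.Site d)} (hI : I ⊆ Λ \ Γ)
    (hbox : ∀ y : ↥(Λ \ Γ), (y : B1Eq324BenfattoLemma.Site d) ∈ I ↔ π y = p)
    (u : B1Eq324BenfattoLemma.Site d → ℝ) {F : (↥I → ℝ) → ℝ≥0∞} (hF : Measurable F) :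
    ∫⁻ z, F (I.restrict z) ∂((gaussianFieldOfKernel K₂).map
        fun (ζ : B1Eq324BenfattoLemma.Site d → ℝ) (x : B1Eq324BenfattoLemma.Site d) => u x + ζ x) =
      ∫⁻ y, F (ofLp y) ∂multivariateGaussian (toLp 2 (I.restrict u))
        (A.submatrix (fun j : ↥I => (⟨j, (Finset.mem_sdiff.mp (hI j.2)).1⟩ : Λ))
            (fun j : ↥I => (⟨j, (Finset.mem_sdiff.mp (hI j.2)).1⟩ : Λ)) +
          c • Matrix.diagonal (fun j : ↥I => r ⟨j, hI j.2⟩))⁻¹ := by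
  rw [lintegral_comp_restrict_shift_window_eq hK₂ hPD π (comparisonPrecision_apply_eq_zero_of_ne π r c) hI
      (saturated_of_box π p hbox) u hF,
    comparisonPrecision_submatrix_box_eq π r c p hI hbox]

end Boxes

/-! ## §3  The class (5.13): the product over the boxes, two-sided, on the conditioned class field -/

section ClassFactorisation

variable {Λ : Finset (B1Eq324BenfattoLemma.Site d)} {A : Matrix Λ Λ ℝ}
  {K : B1Eq324BenfattoLemma.Site d → B1Eq324BenfattoLemma.Site d → ℝ}
  (hK : ∀ x y, K x y = if h : x ∈ Λ ∧ y ∈ Λ then (A⁻¹ : Matrix Λ Λ ℝ) ⟨x, h.1⟩ ⟨y, h.2⟩ else 0)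

include hK

/-- **THE CLASS (5.13), upper** — «the integral factorizes over the boxes» at an exponentially decaying precision.  Setting: the class
kernel `K` of a symmetric `γ`-coercive precision `A` on `Λ`; corridors `Γ ⊆ Λ`; a partition `π` of `↥(Λ ∖ Γ)` whose parts are given as
`Q₀`-windows `box p = {y ∈ Λ ∖ Γ : π y = p}`; cross-row-sum bounds `Σ_{π y′ ≠ π y}|A_{yy′}| ≤ r_y ≤ r_max < γ`; `ρ := (Σ_y r_y)/(γ − r_max)`.  Then
for measurable `F_p ≥ 0` of the box fields,
`∫⁻ Π_p F_p(z|_{box p}) dP̄^K_{Γ,z̄} ≤ e^{ρ} · Π_p ∫⁻ F_p dN(u_Γ(z̄)|_{box p}, (A|_{box p} − diag(r|_{box p}))⁻¹)`: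
`…KernelComparisonExtensive.lintegral_restrict_condFieldK_le_blockDiagDiag` at the zero-extended kernel of `((A|_{Λ∖Γ})_bd − diag r)⁻¹`, the
independence of the box fields under that comparison field (`…KernelComparison.iIndepFun_shift_of_kernel_eq_zero` with
`…KernelComparisonExtensive.kernel_blockDiagDiag_eq_zero_of_ne`), Mathlib's `lintegral_prod_eq_prod_lintegral_of_indepFun`, and §2's per-box law.
The free-field statement it replaces is `…Sect5Eq515.integral_boxes_factorise_eq` (exact Markov property, (5.13) as printed).
[cite: BenfattoEtAl1978, §5 (5.13) p.155, (5.36) p.159, p.153 «factorize “over the boxes □”» (class substitute, extensive form; ours)] -/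
theorem lintegral_prod_restrict_condFieldK_le_exp_mul_prod {σ : Type*} [Fintype σ] [DecidableEq σ]
    (hAs : ∀ e e', A e e' = A e' e) {γ rmax : ℝ} (hγ0 : 0 < γ)
    (hγ : ∀ x : Λ → ℝ, γ * ∑ e, x e ^ 2 ≤ ∑ e, ∑ e', A e e' * x e * x e')
    {Γ : Finset (B1Eq324BenfattoLemma.Site d)} (hΓ : Γ ⊆ Λ) (π : ↥(Λ \ Γ) → σ) (r : ↥(Λ \ Γ) → ℝ)
    (hr : ∀ y : ↥(Λ \ Γ), ∑ y' : ↥(Λ \ Γ), (if π y = π y' then (0 : ℝ) else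
      |A ⟨y, (Finset.mem_sdiff.mp y.2).1⟩ ⟨y', (Finset.mem_sdiff.mp y'.2).1⟩|) ≤ r y)
    (hrmax : ∀ y, r y ≤ rmax) (hγr : rmax < γ) (zbar : B1Eq324BenfattoLemma.Site d → ℝ)
    (box : σ → Finset (B1Eq324BenfattoLemma.Site d)) (hboxsub : ∀ p, box p ⊆ Λ \ Γ)
    (hbox : ∀ p (y : ↥(Λ \ Γ)), (y : B1Eq324BenfattoLemma.Site d) ∈ box p ↔ π y = p)
    {F : (p : σ) → (↥(box p) → ℝ) → ℝ≥0∞} (hF : ∀ p, Measurable (F p)) :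
    ∫⁻ z, ∏ p, F p ((box p).restrict z) ∂((gaussianFieldOfKernel (condCov K Γ)).map
        fun (ζ : B1Eq324BenfattoLemma.Site d → ℝ) (x : B1Eq324BenfattoLemma.Site d) => condMean K Γ zbar x + ζ x) ≤
      ENNReal.ofReal (Real.exp ((∑ y, r y) / (γ - rmax))) *
        ∏ p, ∫⁻ y, F p (ofLp y) ∂multivariateGaussian (toLp 2 ((box p).restrict (condMean K Γ zbar)))
          (A.submatrix (fun j : ↥(box p) => (⟨j, (Finset.mem_sdiff.mp (hboxsub p j.2)).1⟩ : Λ))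
              (fun j : ↥(box p) => (⟨j, (Finset.mem_sdiff.mp (hboxsub p j.2)).1⟩ : Λ)) -
            Matrix.diagonal (fun j : ↥(box p) => r ⟨j, hboxsub p j.2⟩))⁻¹ := by
  classical
  -- the conditional precision, its block-diagonal part and the lower comparison precision
  set B : Matrix ↥(Λ \ Γ) ↥(Λ \ Γ) ℝ := A.submatrix (fun j : ↥(Λ \ Γ) => (⟨j, (Finset.mem_sdiff.mp j.2).1⟩ : Λ))
    (fun j : ↥(Λ \ Γ) => (⟨j, (Finset.mem_sdiff.mp j.2).1⟩ : Λ)) with hB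
  have hBs : ∀ y y', B y y' = B y' y := fun y y' => hAs _ _
  have hBγ : ∀ v : ↥(Λ \ Γ) → ℝ, γ * ∑ y, v y ^ 2 ≤ ∑ y, ∑ y', B y y' * v y * v y' := coercive_submatrix_sdiff hγ Γ
  have hrB : ∀ y : ↥(Λ \ Γ), ∑ y' : ↥(Λ \ Γ), (if π y = π y' then (0 : ℝ) else |B y y'|) ≤ r y := fun y => by
    simpa only [hB, Matrix.submatrix_apply] using hr y
  have hBbd : (Matrix.of fun y y' : ↥(Λ \ Γ) => if π y = π y' then
        A ⟨y, (Finset.mem_sdiff.mp y.2).1⟩ ⟨y', (Finset.mem_sdiff.mp y'.2).1⟩ else 0) =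
      (Matrix.of fun y y' : ↥(Λ \ Γ) => if π y = π y' then B y y' else 0 : Matrix ↥(Λ \ Γ) ↥(Λ \ Γ) ℝ) := by
    ext y y'
    simp only [Matrix.of_apply, hB, Matrix.submatrix_apply]
  have hPD : ((Matrix.of fun y y' : ↥(Λ \ Γ) => if π y = π y' then
        A ⟨y, (Finset.mem_sdiff.mp y.2).1⟩ ⟨y', (Finset.mem_sdiff.mp y'.2).1⟩ else 0) - Matrix.diagonal r).PosDef := by
    rw [hBbd]
    exact (decoupling_extensive hBs π r hBγ hrB hrmax hγr (fun _ => 0) measurable_const).1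
  -- the zero-extended comparison kernel (a local abbreviation of a function; no definition)
  set K₂ : B1Eq324BenfattoLemma.Site d → B1Eq324BenfattoLemma.Site d → ℝ := fun x y =>
    if h : x ∈ Λ \ Γ ∧ y ∈ Λ \ Γ then
      ((((Matrix.of fun y y' : ↥(Λ \ Γ) => if π y = π y' then
          A ⟨y, (Finset.mem_sdiff.mp y.2).1⟩ ⟨y', (Finset.mem_sdiff.mp y'.2).1⟩ else 0) - Matrix.diagonal r)⁻¹ :
        Matrix ↥(Λ \ Γ) ↥(Λ \ Γ) ℝ) ⟨x, h.1⟩ ⟨y, h.2⟩) else 0 with hK₂def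
  have hK₂ : ∀ x y, K₂ x y = if h : x ∈ Λ \ Γ ∧ y ∈ Λ \ Γ then
      ((((Matrix.of fun y y' : ↥(Λ \ Γ) => if π y = π y' then
          A ⟨y, (Finset.mem_sdiff.mp y.2).1⟩ ⟨y', (Finset.mem_sdiff.mp y'.2).1⟩ else 0) - Matrix.diagonal r)⁻¹ :
        Matrix ↥(Λ \ Γ) ↥(Λ \ Γ) ℝ) ⟨x, h.1⟩ ⟨y, h.2⟩) else 0 := fun x y => rfl
  have hK₂psd : IsPosSemidefKernel K₂ := isPosSemidefKernel_kernel hK₂ hPD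
  have h₂ := covGram_kernel_eq_inv hK₂
  -- Step 1: J3's domination, for the product observable
  have hGm : Measurable (fun v : ↥(Λ \ Γ) → ℝ => ∏ p, F p (fun j : ↥(box p) => v ⟨j, hboxsub p j.2⟩)) :=
    Finset.measurable_prod (f := fun p (v : ↥(Λ \ Γ) → ℝ) => F p (fun j : ↥(box p) => v ⟨j, hboxsub p j.2⟩)) Finset.univ
      fun p _ => (hF p).comp (measurable_pi_lambda _ fun j => measurable_pi_apply _)
  have hdom : ∫⁻ z, ∏ p, F p ((box p).restrict z) ∂((gaussianFieldOfKernel (condCov K Γ)).map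
        fun (ζ : B1Eq324BenfattoLemma.Site d → ℝ) (x : B1Eq324BenfattoLemma.Site d) => condMean K Γ zbar x + ζ x) ≤
      ENNReal.ofReal (Real.exp ((∑ y, r y) / (γ - rmax))) *
        ∫⁻ z, ∏ p, F p ((box p).restrict z) ∂((gaussianFieldOfKernel K₂).map
          fun (ζ : B1Eq324BenfattoLemma.Site d → ℝ) (x : B1Eq324BenfattoLemma.Site d) => condMean K Γ zbar x + ζ x) :=
    lintegral_restrict_condFieldK_le_blockDiagDiag hK hAs hγ0 hγ hΓ π r hr hrmax hγr zbar hK₂psd h₂ hGm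
  -- Step 2: the box fields are independent under the comparison field
  have hPform : ((Matrix.of fun y y' : ↥(Λ \ Γ) => if π y = π y' then
        A ⟨y, (Finset.mem_sdiff.mp y.2).1⟩ ⟨y', (Finset.mem_sdiff.mp y'.2).1⟩ else 0) - Matrix.diagonal r) =
      (Matrix.of fun a b : ↥(Λ \ Γ) => if π a = π b then B a b else 0 : Matrix ↥(Λ \ Γ) ↥(Λ \ Γ) ℝ) +
        (-1 : ℝ) • Matrix.diagonal r := by
    rw [hBbd, neg_one_smul, ← sub_eq_add_neg]
  have hvan : ∀ p q, p ≠ q → ∀ s ∈ ((box p : Finset (B1Eq324BenfattoLemma.Site d)) : Set (B1Eq324BenfattoLemma.Site d)),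
      ∀ t ∈ ((box q : Finset (B1Eq324BenfattoLemma.Site d)) : Set (B1Eq324BenfattoLemma.Site d)), K₂ s t = 0 := by
    intro p q hpq s hs t ht
    rw [Finset.mem_coe] at hs ht
    refine kernel_blockDiagDiag_eq_zero_of_ne hK₂ B π r (-1) hPform hPD fun hs' ht' => ?_
    rw [(hbox p ⟨s, hs'⟩).mp hs, (hbox q ⟨t, ht'⟩).mp ht]
    exact hpq
  have hind := iIndepFun_shift_of_kernel_eq_zero hK₂psd
    (Ω := fun p => ((box p : Finset (B1Eq324BenfattoLemma.Site d)) : Set (B1Eq324BenfattoLemma.Site d))) hvan (condMean K Γ zbar)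
  have hind' : iIndepFun (fun p (z : B1Eq324BenfattoLemma.Site d → ℝ) => F p ((box p).restrict z))
      ((gaussianFieldOfKernel K₂).map
        fun (ζ : B1Eq324BenfattoLemma.Site d → ℝ) (x : B1Eq324BenfattoLemma.Site d) => condMean K Γ zbar x + ζ x) :=
    hind.comp (fun p (v : ↥((box p : Finset (B1Eq324BenfattoLemma.Site d)) : Set (B1Eq324BenfattoLemma.Site d)) → ℝ) =>
        F p (fun j : ↥(box p) => v ⟨(j : B1Eq324BenfattoLemma.Site d), j.2⟩))
      fun p => (hF p).comp (measurable_pi_lambda _ fun j => measurable_pi_apply _)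
  have hprod := lintegral_prod_eq_prod_lintegral_of_indepFun Finset.univ
    (fun p (z : B1Eq324BenfattoLemma.Site d → ℝ) => F p ((box p).restrict z)) hind'
    fun p => (hF p).comp (Finset.measurable_restrict (box p))
  -- Step 3: the per-box laws
  have hlaw : ∀ p, ∫⁻ z, F p ((box p).restrict z) ∂((gaussianFieldOfKernel K₂).map
        fun (ζ : B1Eq324BenfattoLemma.Site d → ℝ) (x : B1Eq324BenfattoLemma.Site d) => condMean K Γ zbar x + ζ x) =
      ∫⁻ y, F p (ofLp y) ∂multivariateGaussian (toLp 2 ((box p).restrict (condMean K Γ zbar)))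
        (A.submatrix (fun j : ↥(box p) => (⟨j, (Finset.mem_sdiff.mp (hboxsub p j.2)).1⟩ : Λ))
            (fun j : ↥(box p) => (⟨j, (Finset.mem_sdiff.mp (hboxsub p j.2)).1⟩ : Λ)) -
          Matrix.diagonal (fun j : ↥(box p) => r ⟨j, hboxsub p j.2⟩))⁻¹ := fun p => by
    rw [lintegral_comp_restrict_shift_window_eq hK₂ hPD π (comparisonPrecision_sub_apply_eq_zero_of_ne π r) (hboxsub p)
        (saturated_of_box π p (hbox p)) (condMean K Γ zbar) (hF p),
      comparisonPrecision_sub_submatrix_box_eq π r p (hboxsub p) (hbox p)]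
  calc ∫⁻ z, ∏ p, F p ((box p).restrict z) ∂((gaussianFieldOfKernel (condCov K Γ)).map
          fun (ζ : B1Eq324BenfattoLemma.Site d → ℝ) (x : B1Eq324BenfattoLemma.Site d) => condMean K Γ zbar x + ζ x)
      ≤ ENNReal.ofReal (Real.exp ((∑ y, r y) / (γ - rmax))) *
          ∫⁻ z, ∏ p, F p ((box p).restrict z) ∂((gaussianFieldOfKernel K₂).map
            fun (ζ : B1Eq324BenfattoLemma.Site d → ℝ) (x : B1Eq324BenfattoLemma.Site d) => condMean K Γ zbar x + ζ x) := hdom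
    _ = ENNReal.ofReal (Real.exp ((∑ y, r y) / (γ - rmax))) *
          ∏ p, ∫⁻ z, F p ((box p).restrict z) ∂((gaussianFieldOfKernel K₂).map
            fun (ζ : B1Eq324BenfattoLemma.Site d → ℝ) (x : B1Eq324BenfattoLemma.Site d) => condMean K Γ zbar x + ζ x) := by
        rw [hprod]
    _ = _ := by
        congr 1
        exact Finset.prod_congr rfl fun p _ => hlaw p

/-- **THE CLASS (5.13), lower**: with the same data,
`e^{−ρ} · Π_p ∫⁻ F_p dN(u_Γ(z̄)|_{box p}, (A|_{box p} + diag(r|_{box p}))⁻¹) ≤ ∫⁻ Π_p F_p(z|_{box p}) dP̄^K_{Γ,z̄}` — the upper comparison precision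
`(A|_{Λ∖Γ})_bd + diag r`, factorised over its boxes. [cite: BenfattoEtAl1978, §5 (5.13) p.155, (5.15) p.155 (class substitute, extensive form; ours)] -/
theorem exp_mul_prod_lintegral_le_lintegral_prod_restrict_condFieldK {σ : Type*} [Fintype σ] [DecidableEq σ]
    (hAs : ∀ e e', A e e' = A e' e) {γ rmax : ℝ} (hγ0 : 0 < γ)
    (hγ : ∀ x : Λ → ℝ, γ * ∑ e, x e ^ 2 ≤ ∑ e, ∑ e', A e e' * x e * x e')
    {Γ : Finset (B1Eq324BenfattoLemma.Site d)} (hΓ : Γ ⊆ Λ) (π : ↥(Λ \ Γ) → σ) (r : ↥(Λ \ Γ) → ℝ)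
    (hr : ∀ y : ↥(Λ \ Γ), ∑ y' : ↥(Λ \ Γ), (if π y = π y' then (0 : ℝ) else
      |A ⟨y, (Finset.mem_sdiff.mp y.2).1⟩ ⟨y', (Finset.mem_sdiff.mp y'.2).1⟩|) ≤ r y)
    (hrmax : ∀ y, r y ≤ rmax) (hγr : rmax < γ) (zbar : B1Eq324BenfattoLemma.Site d → ℝ)
    (box : σ → Finset (B1Eq324BenfattoLemma.Site d)) (hboxsub : ∀ p, box p ⊆ Λ \ Γ)
    (hbox : ∀ p (y : ↥(Λ \ Γ)), (y : B1Eq324BenfattoLemma.Site d) ∈ box p ↔ π y = p)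
    {F : (p : σ) → (↥(box p) → ℝ) → ℝ≥0∞} (hF : ∀ p, Measurable (F p)) :
    ENNReal.ofReal (Real.exp (-((∑ y, r y) / (γ - rmax)))) *
        ∏ p, ∫⁻ y, F p (ofLp y) ∂multivariateGaussian (toLp 2 ((box p).restrict (condMean K Γ zbar)))
          (A.submatrix (fun j : ↥(box p) => (⟨j, (Finset.mem_sdiff.mp (hboxsub p j.2)).1⟩ : Λ))
              (fun j : ↥(box p) => (⟨j, (Finset.mem_sdiff.mp (hboxsub p j.2)).1⟩ : Λ)) +
            Matrix.diagonal (fun j : ↥(box p) => r ⟨j, hboxsub p j.2⟩))⁻¹ ≤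
      ∫⁻ z, ∏ p, F p ((box p).restrict z) ∂((gaussianFieldOfKernel (condCov K Γ)).map
        fun (ζ : B1Eq324BenfattoLemma.Site d → ℝ) (x : B1Eq324BenfattoLemma.Site d) => condMean K Γ zbar x + ζ x) := by
  classical
  -- the conditional precision, its block-diagonal part and the upper comparison precision
  set B : Matrix ↥(Λ \ Γ) ↥(Λ \ Γ) ℝ := A.submatrix (fun j : ↥(Λ \ Γ) => (⟨j, (Finset.mem_sdiff.mp j.2).1⟩ : Λ))
    (fun j : ↥(Λ \ Γ) => (⟨j, (Finset.mem_sdiff.mp j.2).1⟩ : Λ)) with hB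
  have hBs : ∀ y y', B y y' = B y' y := fun y y' => hAs _ _
  have hBγ : ∀ v : ↥(Λ \ Γ) → ℝ, γ * ∑ y, v y ^ 2 ≤ ∑ y, ∑ y', B y y' * v y * v y' := coercive_submatrix_sdiff hγ Γ
  have hrB : ∀ y : ↥(Λ \ Γ), ∑ y' : ↥(Λ \ Γ), (if π y = π y' then (0 : ℝ) else |B y y'|) ≤ r y := fun y => by
    simpa only [hB, Matrix.submatrix_apply] using hr y
  have hBbd : (Matrix.of fun y y' : ↥(Λ \ Γ) => if π y = π y' then
        A ⟨y, (Finset.mem_sdiff.mp y.2).1⟩ ⟨y', (Finset.mem_sdiff.mp y'.2).1⟩ else 0) =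
      (Matrix.of fun y y' : ↥(Λ \ Γ) => if π y = π y' then B y y' else 0 : Matrix ↥(Λ \ Γ) ↥(Λ \ Γ) ℝ) := by
    ext y y'
    simp only [Matrix.of_apply, hB, Matrix.submatrix_apply]
  have hPD : ((Matrix.of fun y y' : ↥(Λ \ Γ) => if π y = π y' then
        A ⟨y, (Finset.mem_sdiff.mp y.2).1⟩ ⟨y', (Finset.mem_sdiff.mp y'.2).1⟩ else 0) + (1 : ℝ) • Matrix.diagonal r).PosDef := by
    rw [hBbd, one_smul]
    exact (decoupling_extensive hBs π r hBγ hrB hrmax hγr (fun _ => 0) measurable_const).2.1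
  -- the zero-extended comparison kernel (a local abbreviation of a function; no definition)
  set K₂ : B1Eq324BenfattoLemma.Site d → B1Eq324BenfattoLemma.Site d → ℝ := fun x y =>
    if h : x ∈ Λ \ Γ ∧ y ∈ Λ \ Γ then
      ((((Matrix.of fun y y' : ↥(Λ \ Γ) => if π y = π y' then
          A ⟨y, (Finset.mem_sdiff.mp y.2).1⟩ ⟨y', (Finset.mem_sdiff.mp y'.2).1⟩ else 0) + (1 : ℝ) • Matrix.diagonal r)⁻¹ :
        Matrix ↥(Λ \ Γ) ↥(Λ \ Γ) ℝ) ⟨x, h.1⟩ ⟨y, h.2⟩) else 0 with hK₂def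
  have hK₂ : ∀ x y, K₂ x y = if h : x ∈ Λ \ Γ ∧ y ∈ Λ \ Γ then
      ((((Matrix.of fun y y' : ↥(Λ \ Γ) => if π y = π y' then
          A ⟨y, (Finset.mem_sdiff.mp y.2).1⟩ ⟨y', (Finset.mem_sdiff.mp y'.2).1⟩ else 0) + (1 : ℝ) • Matrix.diagonal r)⁻¹ :
        Matrix ↥(Λ \ Γ) ↥(Λ \ Γ) ℝ) ⟨x, h.1⟩ ⟨y, h.2⟩) else 0 := fun x y => rfl
  have hK₂psd : IsPosSemidefKernel K₂ := isPosSemidefKernel_kernel hK₂ hPD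
  have h₂ : covGram K₂ (Λ \ Γ) = ((Matrix.of fun y y' : ↥(Λ \ Γ) => if π y = π y' then
        A ⟨y, (Finset.mem_sdiff.mp y.2).1⟩ ⟨y', (Finset.mem_sdiff.mp y'.2).1⟩ else 0) + Matrix.diagonal r)⁻¹ := by
    rw [covGram_kernel_eq_inv hK₂, one_smul]
  -- Step 1: J3's domination, for the product observable
  have hGm : Measurable (fun v : ↥(Λ \ Γ) → ℝ => ∏ p, F p (fun j : ↥(box p) => v ⟨j, hboxsub p j.2⟩)) :=
    Finset.measurable_prod (f := fun p (v : ↥(Λ \ Γ) → ℝ) => F p (fun j : ↥(box p) => v ⟨j, hboxsub p j.2⟩)) Finset.univ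
      fun p _ => (hF p).comp (measurable_pi_lambda _ fun j => measurable_pi_apply _)
  have hdom : ENNReal.ofReal (Real.exp (-((∑ y, r y) / (γ - rmax)))) *
        ∫⁻ z, ∏ p, F p ((box p).restrict z) ∂((gaussianFieldOfKernel K₂).map
          fun (ζ : B1Eq324BenfattoLemma.Site d → ℝ) (x : B1Eq324BenfattoLemma.Site d) => condMean K Γ zbar x + ζ x) ≤
      ∫⁻ z, ∏ p, F p ((box p).restrict z) ∂((gaussianFieldOfKernel (condCov K Γ)).map
        fun (ζ : B1Eq324BenfattoLemma.Site d → ℝ) (x : B1Eq324BenfattoLemma.Site d) => condMean K Γ zbar x + ζ x) :=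
    lintegral_restrict_condFieldK_ge_blockDiagDiag hK hAs hγ0 hγ hΓ π r hr hrmax hγr zbar hK₂psd h₂ hGm
  -- Step 2: the box fields are independent under the comparison field
  have hPform : ((Matrix.of fun y y' : ↥(Λ \ Γ) => if π y = π y' then
        A ⟨y, (Finset.mem_sdiff.mp y.2).1⟩ ⟨y', (Finset.mem_sdiff.mp y'.2).1⟩ else 0) + (1 : ℝ) • Matrix.diagonal r) =
      (Matrix.of fun a b : ↥(Λ \ Γ) => if π a = π b then B a b else 0 : Matrix ↥(Λ \ Γ) ↥(Λ \ Γ) ℝ) +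
        (1 : ℝ) • Matrix.diagonal r := by
    rw [hBbd]
  have hvan : ∀ p q, p ≠ q → ∀ s ∈ ((box p : Finset (B1Eq324BenfattoLemma.Site d)) : Set (B1Eq324BenfattoLemma.Site d)),
      ∀ t ∈ ((box q : Finset (B1Eq324BenfattoLemma.Site d)) : Set (B1Eq324BenfattoLemma.Site d)), K₂ s t = 0 := by
    intro p q hpq s hs t ht
    rw [Finset.mem_coe] at hs ht
    refine kernel_blockDiagDiag_eq_zero_of_ne hK₂ B π r 1 hPform hPD fun hs' ht' => ?_
    rw [(hbox p ⟨s, hs'⟩).mp hs, (hbox q ⟨t, ht'⟩).mp ht]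
    exact hpq
  have hind := iIndepFun_shift_of_kernel_eq_zero hK₂psd
    (Ω := fun p => ((box p : Finset (B1Eq324BenfattoLemma.Site d)) : Set (B1Eq324BenfattoLemma.Site d))) hvan (condMean K Γ zbar)
  have hind' : iIndepFun (fun p (z : B1Eq324BenfattoLemma.Site d → ℝ) => F p ((box p).restrict z))
      ((gaussianFieldOfKernel K₂).map
        fun (ζ : B1Eq324BenfattoLemma.Site d → ℝ) (x : B1Eq324BenfattoLemma.Site d) => condMean K Γ zbar x + ζ x) :=
    hind.comp (fun p (v : ↥((box p : Finset (B1Eq324BenfattoLemma.Site d)) : Set (B1Eq324BenfattoLemma.Site d)) → ℝ) =>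
        F p (fun j : ↥(box p) => v ⟨(j : B1Eq324BenfattoLemma.Site d), j.2⟩))
      fun p => (hF p).comp (measurable_pi_lambda _ fun j => measurable_pi_apply _)
  have hprod := lintegral_prod_eq_prod_lintegral_of_indepFun Finset.univ
    (fun p (z : B1Eq324BenfattoLemma.Site d → ℝ) => F p ((box p).restrict z)) hind'
    fun p => (hF p).comp (Finset.measurable_restrict (box p))
  -- Step 3: the per-box laws
  have hlaw : ∀ p, ∫⁻ z, F p ((box p).restrict z) ∂((gaussianFieldOfKernel K₂).map
        fun (ζ : B1Eq324BenfattoLemma.Site d → ℝ) (x : B1Eq324BenfattoLemma.Site d) => condMean K Γ zbar x + ζ x) =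
      ∫⁻ y, F p (ofLp y) ∂multivariateGaussian (toLp 2 ((box p).restrict (condMean K Γ zbar)))
        (A.submatrix (fun j : ↥(box p) => (⟨j, (Finset.mem_sdiff.mp (hboxsub p j.2)).1⟩ : Λ))
            (fun j : ↥(box p) => (⟨j, (Finset.mem_sdiff.mp (hboxsub p j.2)).1⟩ : Λ)) +
          Matrix.diagonal (fun j : ↥(box p) => r ⟨j, hboxsub p j.2⟩))⁻¹ := fun p => by
    rw [lintegral_comp_restrict_comparison_box_eq π r 1 hPD hK₂ p (hboxsub p) (hbox p) (condMean K Γ zbar) (hF p), one_smul]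
  calc ENNReal.ofReal (Real.exp (-((∑ y, r y) / (γ - rmax)))) *
        ∏ p, ∫⁻ y, F p (ofLp y) ∂multivariateGaussian (toLp 2 ((box p).restrict (condMean K Γ zbar)))
          (A.submatrix (fun j : ↥(box p) => (⟨j, (Finset.mem_sdiff.mp (hboxsub p j.2)).1⟩ : Λ))
              (fun j : ↥(box p) => (⟨j, (Finset.mem_sdiff.mp (hboxsub p j.2)).1⟩ : Λ)) +
            Matrix.diagonal (fun j : ↥(box p) => r ⟨j, hboxsub p j.2⟩))⁻¹
      = ENNReal.ofReal (Real.exp (-((∑ y, r y) / (γ - rmax)))) *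
          ∏ p, ∫⁻ z, F p ((box p).restrict z) ∂((gaussianFieldOfKernel K₂).map
            fun (ζ : B1Eq324BenfattoLemma.Site d → ℝ) (x : B1Eq324BenfattoLemma.Site d) => condMean K Γ zbar x + ζ x) := by
        congr 1
        exact Finset.prod_congr rfl fun p _ => (hlaw p).symm
    _ = ENNReal.ofReal (Real.exp (-((∑ y, r y) / (γ - rmax)))) *
          ∫⁻ z, ∏ p, F p ((box p).restrict z) ∂((gaussianFieldOfKernel K₂).map
            fun (ζ : B1Eq324BenfattoLemma.Site d → ℝ) (x : B1Eq324BenfattoLemma.Site d) => condMean K Γ zbar x + ζ x) := by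
        rw [hprod]
    _ ≤ _ := hdom

end ClassFactorisation

end Literature.MathematicalPhysics.QuantumFieldTheory.Balaban1983to89.B1Eq324BenfattoKernelComparisonBoxes

end
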